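import Summits.AtomisticToContinuum.HydrodynamicLimit.Theorems.OneFlightGossipEngineEnergyCurrentTailsFirstPartnerObjects
import Summits.AtomisticToContinuum.HydrodynamicLimit.Theorems.JParityClosureRateFloorWindowFloorRung0
import HarnessLib

/-!
# Crux `EnergyCurrentTails` (stmt-AtomisticToContinuum-9235), line `quartic-schur-ledger`, rung-0 certificate of T′:
# H1, the PATHWISE transfer `firstPartnerRung0_pathwise` (helper file, `--supports stmt-AtomisticToContinuum-9235`)

The sure (pathwise) link between the static tube double sum of the BAND mixing mark and the line's first-partner sum.
Fix `N + 1` spheres of diameter `ε` on `𝕋³ × ℝ³` (configuration `z`), a look-ahead ratio `κ ≥ 0`, a look-ahead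
`Δ ≥ κε`, thresholds `K₀, K₁, K₂` (no sign needed; the registered form also carries `0 ≤ K₁`, `0 ≤ K₂`), and the
band mark

  `Ξ'(n, v, w) = 𝟙{K₀ < ‖v‖ ≤ K₂, ‖w‖ ≤ K₁} · 2‖v′‖²‖w′‖²`,  `(v′, w′) = reflectVel n (v, w)`.

If `ε (1 + 2κ(K₁ + K₂ + 1)) < 1/2` then (`tubeSum_band_le`, registered closed form `firstPartnerRung0_pathwise`)

  `Σ_{i ≠ j} pairTubeMark ε κ Ξ' i j x v ≤ (N+1) · firstPartnerSum ε Δ z s (mixMark N K₀ K₁) + (K₂²+K₁²)²/2 · #B`,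

`B` = the would-be pairs of the window `(0, κε]` of out-degree `≥ 2` (another would-be pair issued from the same
first particle).

**Proof** (after `RateFloorWindowFloor.tubeSum_trunc_le_wouldBeSum`).  Termwise, for `i ≠ j` with a nonzero tube
term the band condition gives `‖vᵢ − vⱼ‖ ≤ K₁ + K₂`, so the chart hypothesis `ε(1 + 2κ‖vᵢ − vⱼ‖) < 1/2` holds and
(`RateFloorTubeBridge`) the pair is a would-be pair of the window `(0, κε]` whose predicted separation at its first
contact time is `ε ×` the tube's impact normal.  If the pair has out-degree one, it is a FIRST pair for the longer
look-ahead `Δ` (would-be pairs and first contact times are monotone in the window: `wouldBePairs_mono`,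
`firstContact_eq_of_mem_wouldBePairs`, `mem_firstPairs_of_outDegree_one`), and its `mixMark` at the predicted datum
is `(N+1)⁻¹ Ξ'` (`reflectVel_smul`: the reflection law only sees the line of the separation).  Otherwise the term is
bounded by `2‖v′‖²‖w′‖² ≤ (‖v′‖² + ‖w′‖²)²/2 = (‖v‖² + ‖w‖²)²/2 ≤ (K₂² + K₁²)²/2` (energy conservation
`norm_sq_reflectVel_fst_add_norm_sq_reflectVel_snd`).  Summation: the out-degree-one pairs form a subset of
`firstPairs ε Δ z` and all mixing marks are `≥ 0`.

References: Gallagher–Saint-Raymond–Texier 2013 §4.1 (collision cylinders); elementary.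
-/

noncomputable section

open scoped BigOperators Classical ENNReal InnerProductSpace
open MeasureTheory Set
open Literature.Analysis.FluidPDE Literature.MathematicalPhysics.KineticTheory
  Literature.MathematicalPhysics.StatisticalMechanics

namespace Summit.AtomisticToContinuum.HydrodynamicLimit.Theorems

namespace QuarticSchurLedger

open EnergyCurrentTailsFirstPartner RateFloorLine RateFloorTubeBridge RateFloorWindowFloor

variable {n : ℕ}

/-! ## Monotonicity of the would-be vocabulary in the window length -/

/-- Would-be pairs are monotone in the window length. [folklore] -/
theorem wouldBePairs_mono {ε Δ Δ' : ℝ} (h : Δ' ≤ Δ) (z : Config n (Fin 3) T3) :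
    wouldBePairs ε Δ' z ⊆ wouldBePairs ε Δ z := by
  intro p hp
  simp only [wouldBePairs, Finset.mem_filter, Finset.mem_univ, true_and] at hp ⊢
  obtain ⟨hne, u, hu, hle⟩ := hp
  exact ⟨hne, u, ⟨hu.1, hu.2.trans h⟩, hle⟩

/-- An infimum over `(0, Δ]` of a property witnessed in `(0, Δ']`, `Δ' ≤ Δ`, is the infimum over `(0, Δ']`.
[folklore] -/
private theorem sInf_Ioc_eq_of_witness (P : ℝ → Prop) {Δ Δ' : ℝ} (h : Δ' ≤ Δ) {u₀ : ℝ} (hu₀ : u₀ ∈ Ioc 0 Δ')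
    (hP : P u₀) : sInf {u | u ∈ Ioc 0 Δ ∧ P u} = sInf {u | u ∈ Ioc 0 Δ' ∧ P u} := by
  set S := {u | u ∈ Ioc 0 Δ ∧ P u}
  set S' := {u | u ∈ Ioc 0 Δ' ∧ P u}
  have hS'S : S' ⊆ S := fun u hu => ⟨⟨hu.1.1, hu.1.2.trans h⟩, hu.2⟩
  have hne' : S'.Nonempty := ⟨u₀, hu₀, hP⟩
  have hbdd : BddBelow S := ⟨0, fun u hu => hu.1.1.le⟩
  have hbdd' : BddBelow S' := hbdd.mono hS'S
  refine le_antisymm (csInf_le_csInf hbdd hne' hS'S) (le_csInf (hne'.mono hS'S) fun u hu => ?_)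
  by_cases huΔ : u ≤ Δ'
  · exact csInf_le hbdd' ⟨⟨hu.1.1, huΔ⟩, hu.2⟩
  · exact (csInf_le hbdd' ⟨hu₀, hP⟩).trans (hu₀.2.trans (not_le.1 huΔ).le)

/-- The first contact time of a would-be pair of the window `(0, Δ']` is the same for every longer window.
[folklore] -/
theorem firstContact_eq_of_mem_wouldBePairs {ε Δ Δ' : ℝ} (h : Δ' ≤ Δ) {z : Config n (Fin 3) T3}
    {p : Fin n × Fin n} (hp : p ∈ wouldBePairs ε Δ' z) :
    firstContact ε Δ z p = firstContact ε Δ' z p := by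
  simp only [wouldBePairs, Finset.mem_filter, Finset.mem_univ, true_and] at hp
  obtain ⟨-, u₀, hu₀, hle₀⟩ := hp
  exact sInf_Ioc_eq_of_witness (fun u => ‖(Torus.geometry (Fin 3)).sepVec
    (freeFlight (Torus.geometry (Fin 3)) u z p.1).1 (freeFlight (Torus.geometry (Fin 3)) u z p.2).1‖ ≤ ε) h hu₀ hle₀

/-- The first contact time of a would-be pair of the window `(0, Δ]` is at most `Δ`. [folklore] -/
theorem firstContact_le_of_mem_wouldBePairs {ε Δ : ℝ} {z : Config n (Fin 3) T3} {p : Fin n × Fin n}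
    (hp : p ∈ wouldBePairs ε Δ z) : firstContact ε Δ z p ≤ Δ := by
  simp only [wouldBePairs, Finset.mem_filter, Finset.mem_univ, true_and] at hp
  obtain ⟨-, u₀, hu₀, hle₀⟩ := hp
  unfold firstContact
  refine (csInf_le ?_ ?_).trans hu₀.2
  · exact ⟨0, fun u hu => hu.1.1.le⟩
  · exact ⟨hu₀, hle₀⟩

/-- Below the first contact time of a would-be pair there is no contact; equivalently, a first contact time
`< t` is witnessed by a contact time `< t`. [folklore] -/
theorem exists_contact_lt_of_firstContact_lt {ε Δ : ℝ} {z : Config n (Fin 3) T3} {q : Fin n × Fin n}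
    (hq : q ∈ wouldBePairs ε Δ z) {t : ℝ} (hlt : firstContact ε Δ z q < t) :
    ∃ u ∈ Ioc 0 Δ, u < t ∧ ‖(Torus.geometry (Fin 3)).sepVec
      (freeFlight (Torus.geometry (Fin 3)) u z q.1).1 (freeFlight (Torus.geometry (Fin 3)) u z q.2).1‖ ≤ ε := by
  simp only [wouldBePairs, Finset.mem_filter, Finset.mem_univ, true_and] at hq
  obtain ⟨-, u₁, hu₁, hle₁⟩ := hq
  unfold firstContact at hlt
  obtain ⟨u, hu, hult⟩ := exists_lt_of_csInf_lt (by exact ⟨u₁, hu₁, hle₁⟩) hlt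
  exact ⟨u, hu.1, hult, hu.2⟩

/-- **A would-be pair of out-degree one within `(0, Δ']` is a FIRST pair within every `Δ ≥ Δ'`**: any would-be
pair `(i, j′)` of the longer window with an earlier first contact has a contact time `< firstContact ≤ Δ'`, hence
is a second would-be pair of the short window issued from `i`. [folklore] -/
theorem mem_firstPairs_of_outDegree_one {ε Δ Δ' : ℝ} (h : Δ' ≤ Δ) {z : Config n (Fin 3) T3}
    {p : Fin n × Fin n} (hp : p ∈ wouldBePairs ε Δ' z)
    (hone : ¬ ∃ q ∈ wouldBePairs ε Δ' z, q.1 = p.1 ∧ q ≠ p) : p ∈ firstPairs ε Δ z := by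
  simp only [firstPairs, Finset.mem_filter]
  refine ⟨wouldBePairs_mono h z hp, fun q hq hq1 => ?_⟩
  by_contra hlt
  rw [not_le] at hlt
  have hqp : q ≠ p := by
    rintro rfl
    exact lt_irrefl _ hlt
  rw [firstContact_eq_of_mem_wouldBePairs h hp] at hlt
  obtain ⟨u, hu, hut, hle⟩ := exists_contact_lt_of_firstContact_lt hq hlt
  have huΔ' : u ≤ Δ' := hut.le.trans (firstContact_le_of_mem_wouldBePairs hp)
  have hqne : q.1 ≠ q.2 := by
    have := hq
    simp only [wouldBePairs, Finset.mem_filter, Finset.mem_univ, true_and] at this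
    exact this.1
  refine hone ⟨q, ?_, hq1, hqp⟩
  simp only [wouldBePairs, Finset.mem_filter, Finset.mem_univ, true_and]
  exact ⟨hqne, u, ⟨hu.1, huΔ'⟩, hle⟩

/-! ## The mixing mark -/

/-- The quartic mixing mark is nonnegative. [folklore] -/
theorem mixMark_nonneg (N : ℕ) (K₀ K₁ : ℝ) (t : ℝ) (x y : T3) (v w : V3) : 0 ≤ mixMark N K₀ K₁ t x y v w := by
  unfold mixMark
  split_ifs
  · positivity
  · exact le_rfl

/-- The Povzner product is bounded by the energy: `2‖v′‖²‖w′‖² ≤ (‖v‖² + ‖w‖²)²/2`. [folklore] -/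
theorem two_mul_reflect_sq_mul_sq_le (m v w : V3) :
    2 * (‖(reflectVel m (v, w)).1‖ ^ 2 * ‖(reflectVel m (v, w)).2‖ ^ 2) ≤ (‖v‖ ^ 2 + ‖w‖ ^ 2) ^ 2 / 2 := by
  have he := norm_sq_reflectVel_fst_add_norm_sq_reflectVel_snd m (v, w)
  simp only at he
  nlinarith [sq_nonneg (‖(reflectVel m (v, w)).1‖ ^ 2 - ‖(reflectVel m (v, w)).2‖ ^ 2)]

/-! ## The pathwise transfer -/

/-- **H1 · band tube sum ≤ (N+1)·first-partner sum + C_K·(out-degree ≥ 2 count)** (see the module docstring).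
[folklore] -/
theorem tubeSum_band_le {N : ℕ} {ε κ Δ K₁ K₂ : ℝ} (K₀ : ℝ) (hε : 0 < ε) (hκ : 0 ≤ κ) (hΔ : κ * ε ≤ Δ)
    (hsmall : ε * (1 + 2 * κ * (K₁ + K₂ + 1)) < 1 / 2) (z : Config (N + 1) (Fin 3) T3) (s : ℝ) :
    (∑ i : Fin (N + 1), ∑ j : Fin (N + 1), (if i ≠ j then pairTubeMark ε κ (fun q : V3 × V3 × V3 =>
      if K₀ < ‖q.2.1‖ ∧ ‖q.2.1‖ ≤ K₂ ∧ ‖q.2.2‖ ≤ K₁ then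
        2 * (‖(reflectVel q.1 (q.2.1, q.2.2)).1‖ ^ 2 * ‖(reflectVel q.1 (q.2.1, q.2.2)).2‖ ^ 2) else 0)
          i j (fun m => (z m).1) (fun m => (z m).2) else 0)) ≤
      ((N + 1 : ℕ) : ℝ) * firstPartnerSum ε Δ z s (mixMark N K₀ K₁) +
        (K₂ ^ 2 + K₁ ^ 2) ^ 2 / 2 * (((wouldBePairs ε (κ * ε) z).filter fun p =>
          ∃ q ∈ wouldBePairs ε (κ * ε) z, q.1 = p.1 ∧ q ≠ p).card : ℝ) := by
  set W := wouldBePairs ε (κ * ε) z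
  set B := W.filter fun p => ∃ q ∈ W, q.1 = p.1 ∧ q ≠ p
  set A := W.filter fun p => ¬ ∃ q ∈ W, q.1 = p.1 ∧ q ≠ p
  set C := (K₂ ^ 2 + K₁ ^ 2) ^ 2 / 2 with hC
  -- the first-partner term of an ordered pair (the summand of `firstPartnerSum ε Δ z s (mixMark N K₀ K₁)`)
  set Ft : Fin (N + 1) × Fin (N + 1) → ℝ := fun p =>
    mixMark N K₀ K₁ (s + firstContact ε Δ z p)
      (freeFlight (Torus.geometry (Fin 3)) (firstContact ε Δ z p) z p.1).1
      (freeFlight (Torus.geometry (Fin 3)) (firstContact ε Δ z p) z p.2).1 (z p.1).2 (z p.2).2 with hFt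
  have hFt0 : ∀ p, 0 ≤ Ft p := fun p => mixMark_nonneg _ _ _ _ _ _ _ _
  have hC0 : 0 ≤ C := by positivity
  have hN0 : (0 : ℝ) ≤ ((N + 1 : ℕ) : ℝ) := by positivity
  have hAfirst : A ⊆ firstPairs ε Δ z := fun p hp =>
    mem_firstPairs_of_outDegree_one hΔ (Finset.mem_filter.1 hp).1 (Finset.mem_filter.1 hp).2
  -- termwise domination
  have hterm : ∀ i j : Fin (N + 1),
      (if i ≠ j then pairTubeMark ε κ (fun q : V3 × V3 × V3 =>
        if K₀ < ‖q.2.1‖ ∧ ‖q.2.1‖ ≤ K₂ ∧ ‖q.2.2‖ ≤ K₁ then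
          2 * (‖(reflectVel q.1 (q.2.1, q.2.2)).1‖ ^ 2 * ‖(reflectVel q.1 (q.2.1, q.2.2)).2‖ ^ 2) else 0)
            i j (fun m => (z m).1) (fun m => (z m).2) else 0) ≤
        (if (i, j) ∈ A then ((N + 1 : ℕ) : ℝ) * Ft (i, j) else 0) + (if (i, j) ∈ B then C else 0) := by
    intro i j
    have hR1 : 0 ≤ (if (i, j) ∈ A then ((N + 1 : ℕ) : ℝ) * Ft (i, j) else 0) := by
      split_ifs
      · exact mul_nonneg hN0 (hFt0 _)
      · exact le_rfl
    have hR2 : 0 ≤ (if (i, j) ∈ B then C else 0) := by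
      split_ifs
      · exact hC0
      · exact le_rfl
    by_cases hij : i ≠ j
    · rw [if_pos hij, pairTubeMark_config_eq]
      by_cases hq : ε⁻¹ • (Torus.geometry (Fin 3)).sepVec (z i).1 (z j).1 ∈ strictTube κ ((z i).2 - (z j).2)
      · rw [if_pos hq]
        dsimp only
        by_cases hband : K₀ < ‖(z i).2‖ ∧ ‖(z i).2‖ ≤ K₂ ∧ ‖(z j).2‖ ≤ K₁
        · rw [if_pos hband]
          -- a nonvanishing band mark: the pair is slow, hence inside the chart, hence would-be
          have hw : ‖(z i).2 - (z j).2‖ ≤ K₁ + K₂ + 1 := by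
            calc ‖(z i).2 - (z j).2‖ ≤ ‖(z i).2‖ + ‖(z j).2‖ := norm_sub_le _ _
              _ ≤ K₁ + K₂ + 1 := by linarith [hband.2.1, hband.2.2]
          have hsmall' : ε * (1 + 2 * κ * ‖(z i).2 - (z j).2‖) < 1 / 2 := by
            have : ε * (1 + 2 * κ * ‖(z i).2 - (z j).2‖) ≤ ε * (1 + 2 * κ * (K₁ + K₂ + 1)) := by gcongr
            linarith
          have hchart := chart_of_smul_mem_strictTube hε hq hsmall'
          have hmemW : (i, j) ∈ W := mem_wouldBePairs_of_smul_mem_strictTube hε hij hchart hq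
          by_cases hdeg : ∃ q ∈ W, q.1 = (i, j).1 ∧ q ≠ (i, j)
          · -- out-degree ≥ 2: the constant bound
            have hmemB : (i, j) ∈ B := Finset.mem_filter.2 ⟨hmemW, hdeg⟩
            rw [if_pos hmemB]
            have hv2 : ‖(z i).2‖ ^ 2 ≤ K₂ ^ 2 := pow_le_pow_left₀ (norm_nonneg _) hband.2.1 2
            have hw2 : ‖(z j).2‖ ^ 2 ≤ K₁ ^ 2 := pow_le_pow_left₀ (norm_nonneg _) hband.2.2 2
            have h2 : (‖(z i).2‖ ^ 2 + ‖(z j).2‖ ^ 2) ^ 2 / 2 ≤ C := by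
              rw [hC]
              gcongr (?_) ^ 2 / 2
              exact add_le_add hv2 hw2
            linarith [two_mul_reflect_sq_mul_sq_le
              (impactNormal ((z i).2 - (z j).2) (ε⁻¹ • (Torus.geometry (Fin 3)).sepVec (z i).1 (z j).1))
              (z i).2 (z j).2]
          · -- out-degree one: a first pair, whose predicted datum is the tube's impact normal
            have hmemA : (i, j) ∈ A := Finset.mem_filter.2 ⟨hmemW, hdeg⟩
            have hnB : (i, j) ∉ B := fun h => hdeg (Finset.mem_filter.1 h).2
            rw [if_pos hmemA, if_neg hnB, add_zero]
            have hfc : firstContact ε Δ z (i, j) = firstContact ε (κ * ε) z (i, j) :=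
              firstContact_eq_of_mem_wouldBePairs hΔ hmemW
            have hsep := sepVec_freeFlight_firstContact hε hchart hq
            have hFt_eq : Ft (i, j) = ((N + 1 : ℕ) : ℝ)⁻¹ *
                (2 * (‖(reflectVel (impactNormal ((z i).2 - (z j).2)
                    (ε⁻¹ • (Torus.geometry (Fin 3)).sepVec (z i).1 (z j).1)) ((z i).2, (z j).2)).1‖ ^ 2 *
                  ‖(reflectVel (impactNormal ((z i).2 - (z j).2)
                    (ε⁻¹ • (Torus.geometry (Fin 3)).sepVec (z i).1 (z j).1)) ((z i).2, (z j).2)).2‖ ^ 2)) := by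
              simp only [hFt, mixMark]
              rw [hfc, hsep, reflectVel_smul hε.ne', if_pos ⟨hband.1, hband.2.2⟩]
            rw [hFt_eq, mul_inv_cancel_left₀ (by positivity : ((N + 1 : ℕ) : ℝ) ≠ 0)]
        · rw [if_neg hband]
          exact add_nonneg hR1 hR2
      · rw [if_neg hq]
        exact add_nonneg hR1 hR2
    · rw [if_neg hij]
      exact add_nonneg hR1 hR2
  -- summation
  have hsumA : ∑ p ∈ A, Ft p ≤ firstPartnerSum ε Δ z s (mixMark N K₀ K₁) := by
    simp only [firstPartnerSum, pairSum, hFt]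
    exact Finset.sum_le_sum_of_subset_of_nonneg hAfirst fun p _ _ => mixMark_nonneg _ _ _ _ _ _ _ _
  calc ∑ i : Fin (N + 1), ∑ j : Fin (N + 1), (if i ≠ j then pairTubeMark ε κ (fun q : V3 × V3 × V3 =>
          if K₀ < ‖q.2.1‖ ∧ ‖q.2.1‖ ≤ K₂ ∧ ‖q.2.2‖ ≤ K₁ then
            2 * (‖(reflectVel q.1 (q.2.1, q.2.2)).1‖ ^ 2 * ‖(reflectVel q.1 (q.2.1, q.2.2)).2‖ ^ 2) else 0)
              i j (fun m => (z m).1) (fun m => (z m).2) else 0)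
      ≤ ∑ i : Fin (N + 1), ∑ j : Fin (N + 1),
          ((if (i, j) ∈ A then ((N + 1 : ℕ) : ℝ) * Ft (i, j) else 0) + (if (i, j) ∈ B then C else 0)) :=
        Finset.sum_le_sum fun i _ => Finset.sum_le_sum fun j _ => hterm i j
    _ = ∑ p : Fin (N + 1) × Fin (N + 1),
          ((if p ∈ A then ((N + 1 : ℕ) : ℝ) * Ft p else 0) + (if p ∈ B then C else 0)) := by
        rw [← Fintype.sum_prod_type']
    _ = ((N + 1 : ℕ) : ℝ) * ∑ p ∈ A, Ft p + C * (B.card : ℝ) := by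
        rw [Finset.sum_add_distrib, Fintype.sum_extend_by_zero, Fintype.sum_extend_by_zero, Finset.mul_sum,
          Finset.sum_const, nsmul_eq_mul, mul_comm (B.card : ℝ)]
    _ ≤ ((N + 1 : ℕ) : ℝ) * firstPartnerSum ε Δ z s (mixMark N K₀ K₁) + C * (B.card : ℝ) := by
        gcongr

/-- **Registered helper stub `firstPartnerRung0_pathwise`** (H1 of the rung-0 certificate of T′ `stub_firstPartnerFloor`,
line `quartic-schur-ledger`, crux stmt-AtomisticToContinuum-9235): the closed form of `tubeSum_band_le`. [folklore] -/
theorem firstPartnerRung0_pathwise : ∀ (N : ℕ) (ε κ Δ K₀ K₁ K₂ s : ℝ), 0 < ε → 0 ≤ κ → κ * ε ≤ Δ → 0 ≤ K₁ → 0 ≤ K₂ → ε * (1 + 2 * κ * (K₁ + K₂ + 1)) < 1 / 2 → ∀ z : Config (N + 1) (Fin 3) T3, (∑ i : Fin (N + 1), ∑ j : Fin (N + 1), (if i ≠ j then pairTubeMark ε κ (fun q : V3 × V3 × V3 => if K₀ < ‖q.2.1‖ ∧ ‖q.2.1‖ ≤ K₂ ∧ ‖q.2.2‖ ≤ K₁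 then 2 * (‖(reflectVel q.1 (q.2.1, q.2.2)).1‖ ^ 2 * ‖(reflectVel q.1 (q.2.1, q.2.2)).2‖ ^ 2) else 0) i j (fun m => (z m).1) (fun m => (z m).2) else 0)) ≤ ((N + 1 : ℕ) : ℝ) * firstPartnerSum ε Δ z s (mixMark N K₀ K₁) + (K₂ ^ 2 + K₁ ^ 2) ^ 2 / 2 * (((wouldBePairs ε (κ * ε) z).filter fun p => ∃ q ∈ wouldBePairs ε (κ * ε) z, q.1 = p.1 ∧ q ≠ p).card : ℝ) :=
  fun _N _ε _κ _Δ K₀ _K₁ _K₂ s hε hκ hΔ _hK₁ _hK₂ hsmall z => tubeSum_band_le K₀ hε hκ hΔ hsmall z s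

end QuarticSchurLedger

end Summit.AtomisticToContinuum.HydrodynamicLimit.Theorems

end
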